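import Summits.AtomisticToContinuum.FouriersLaw.Theorems.EmbeddedDrudeMourreAbelThermodynamicLimitAnchoredCorrelationTailsSiteTails
import Summits.AtomisticToContinuum.FouriersLaw.Theorems.EmbeddedDrudeMourreAbelThermodynamicLimitFixedTimeOffsetMatchingProductForm
import Literature.MathematicalPhysics.KineticTheory.InfiniteChainMarkovSuperstable

/-!
# Leaf (B₀) `stub_fixedTimeOffsetMatching` of S4, dynamic half, part 2: the local energy of the centred box has an
`N`-uniform mean `O(R)` under the free Gibbs measure
(crux `EmbeddedDrudeMourre.AbelThermodynamicLimit`, item stmt-AtomisticToContinuum-12596, line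
`loomis-compact-horizon-witness`; `--supports` file proving the registered sub-goal `stub_centredBoxEnergyMean`;
closes nothing)

Buttà–Marchioro's local energy `W_{0,R+1}` of the box `{-(R+1), …, R+1}` (`OscillatorChain.bmLocalEnergy`) controls,
by conservation of the severed energy, every position and momentum along the severed flow of the centred box (part 3);
the good event of the dynamic half asks `W_{0,R+1}(ι_N z) ≤ lam R²/4`. Here: §1 `U, V ≲ 1 + q¹⁶` pointwise for the
pinned anharmonic chain; §2 `∫ W_{0,R+1}(ι_N z) dμ_{N,T} ≤ (2R+3) C` uniformly in `N ≥ 2R + 4` (BM's bound of `W` by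
window sites plus twice the window bonds, `bmLocalEnergy_le_window`; Gaussian momenta; the `N`-uniform one-site
sixteenth position moment `κ₁₆` of part (C), `pinnedChain_lintegral_position_pow_sixteen_le`) — so by Markov the energy
clause of the good event fails with probability `O(1/R)` uniformly in `N` (`stub_centredBoxEnergyMean`).

All statements proved; `[folklore]`. No definitions.
-/

noncomputable section

namespace Summit.AtomisticToContinuum.FouriersLaw.Theorems.AbelThermodynamicLimit.LoomisCompactHorizonWitness

open MeasureTheory ProbabilityTheory Set Filter Topology Function
open scoped NNReal ENNReal
open Literature.MathematicalPhysics.KineticTheory Literature.MathematicalPhysics.KineticTheory.HeatConduction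
open Literature.Probability.Process OscillatorChain
open Summit.AtomisticToContinuum.FouriersLaw.Theorems.NonBallistic
open Summit.AtomisticToContinuum.FouriersLaw.Theorems.PhononMeanFreePath (commonPastBound_gibbsEvenMoments)
variable {N : ℕ} {ω₂ lam β γ : ℝ}

/-! ### §1 Elementary domination of the local energy by one-site sixteenth moments -/

section Domination

/-- `q² ≤ 1 + q¹⁶` and `q⁴ ≤ 1 + q¹⁶`. [folklore] -/
theorem sq_and_pow_four_le_one_add_pow_sixteen (q : ℝ) : q ^ 2 ≤ 1 + q ^ 16 ∧ q ^ 4 ≤ 1 + q ^ 16 := by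
  have h16 : 0 ≤ q ^ 16 := by positivity
  rcases le_or_gt (q ^ 2) 1 with h | h
  · have h4 : q ^ 4 ≤ 1 := by rw [show q ^ 4 = (q ^ 2) ^ 2 by ring]; exact pow_le_one₀ (sq_nonneg q) h
    exact ⟨by linarith, by linarith⟩
  · have h2 : q ^ 2 ≤ q ^ 16 := by
      rw [show q ^ 16 = q ^ 2 * (q ^ 2) ^ 7 by ring]
      exact le_mul_of_one_le_right (sq_nonneg q) (one_le_pow₀ h.le)
    have h4 : q ^ 4 ≤ q ^ 16 := by
      rw [show q ^ 16 = q ^ 4 * (q ^ 2) ^ 6 by ring, show q ^ 4 = (q ^ 2) ^ 2 by ring]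
      exact le_mul_of_one_le_right (by positivity) (one_le_pow₀ h.le)
    exact ⟨by linarith, by linarith⟩

/-- `U(q) = ω₂q²/2 + lam q⁴/4 ≤ (ω₂/2 + lam/4)(1 + q¹⁶)`. [folklore] -/
theorem pinnedChain_U_le_sixteen (hω : 0 ≤ ω₂) (hl : 0 ≤ lam) (β γ : ℝ) (q : ℝ) :
    (pinnedChain ω₂ lam β γ).U q ≤ (ω₂ / 2 + lam / 4) * (1 + q ^ 16) := by
  obtain ⟨h2, h4⟩ := sq_and_pow_four_le_one_add_pow_sixteen q
  show ω₂ * q ^ 2 / 2 + lam * q ^ 4 / 4 ≤ (ω₂ / 2 + lam / 4) * (1 + q ^ 16)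
  nlinarith [mul_le_mul_of_nonneg_left h2 hω, mul_le_mul_of_nonneg_left h4 hl]

/-- `V(q' - q) = r²/2 + βr⁴/4 ≤ (1 + 2β)((1 + q¹⁶) + (1 + q'¹⁶))`. [folklore] -/
theorem pinnedChain_V_sub_le_sixteen (ω₂ lam : ℝ) (hβ : 0 ≤ β) (γ : ℝ) (q q' : ℝ) :
    (pinnedChain ω₂ lam β γ).V (q' - q) ≤ (1 + 2 * β) * ((1 + q ^ 16) + (1 + q' ^ 16)) := by
  obtain ⟨h2, h4⟩ := sq_and_pow_four_le_one_add_pow_sixteen q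
  obtain ⟨h2', h4'⟩ := sq_and_pow_four_le_one_add_pow_sixteen q'
  show (q' - q) ^ 2 / 2 + β * (q' - q) ^ 4 / 4 ≤ (1 + 2 * β) * ((1 + q ^ 16) + (1 + q' ^ 16))
  have hr2 : (q' - q) ^ 2 ≤ 2 * q ^ 2 + 2 * q' ^ 2 := by nlinarith [sq_nonneg (q' + q)]
  have hr4 : (q' - q) ^ 4 ≤ 8 * q ^ 4 + 8 * q' ^ 4 := by
    have : (q' - q) ^ 4 = ((q' - q) ^ 2) ^ 2 := by ring
    rw [this]
    nlinarith [sq_nonneg (q ^ 2 - q' ^ 2), sq_nonneg q, sq_nonneg q', pow_le_pow_left₀ (sq_nonneg (q' - q)) hr2 2]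
  nlinarith [mul_le_mul_of_nonneg_left h4 hβ, mul_le_mul_of_nonneg_left h4' hβ]

end Domination

/-! ### §2 The local energy of the centred box has `N`-uniform mean `O(R)` under the free Gibbs measure -/

section EnergyMean

variable (hω : 0 < ω₂) (hl : 0 < lam) (hβ : 0 < β) {T : ℝ} (hT : 0 < T)
include hω hl hβ hT

/-- **`N`-uniform mean of the local energy of the centred box**: there is `C = C(ω₂, lam, β, T) < ∞` with
`∫⁻ W_{0,R+1}(ι_N z) dμ_{N,T}(z) ≤ (2R + 3) C` for all `R`, `N` with `2R + 4 ≤ N` (BM's `W ≤` window sites + twice the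
window bonds; one-site domination `U, V ≲ 1 + q¹⁶`; Gaussian momenta; the `N`-uniform sixteenth position moment
`κ₁₆`). [folklore] -/
theorem exists_lintegral_bmLocalEnergy_centred_le (γ : ℝ) (ι : (N : ℕ) → PhaseSpace N → ChainConfig)
    (hι : ∀ (N : ℕ) (z : PhaseSpace N) (i : ℤ), ι N z i =
      if h : 0 ≤ i + ((N - 1) / 2 : ℕ) ∧ i + ((N - 1) / 2 : ℕ) < N then
        (z.1 ⟨(i + ((N - 1) / 2 : ℕ)).toNat, by omega⟩, z.2 ⟨(i + ((N - 1) / 2 : ℕ)).toNat, by omega⟩)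
      else (0, 0)) :
    ∃ C : ℝ≥0∞, C ≠ ∞ ∧ ∀ (N R : ℕ), 2 * R + 4 ≤ N →
      ∫⁻ z, ENNReal.ofReal ((pinnedChain ω₂ lam β γ).bmLocalEnergy 0 (R + 1) (ι N z))
          ∂((pinnedChain ω₂ lam β γ).gibbsMeasure N T) ≤ (2 * R + 3 : ℝ≥0∞) * C := by
  set P := pinnedChain ω₂ lam β γ with hP
  set κ : ℝ≥0∞ := (∫⁻ a, ENNReal.ofReal (a ^ 16) * ENNReal.ofReal (Real.exp (-P.U a / T))) /
    ∫⁻ a, ENNReal.ofReal (Real.exp (-P.U a / T)) with hκ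
  set A : ℝ := ω₂ / 2 + lam / 4 with hA
  have hA0 : 0 ≤ A := by positivity
  set Bc : ℝ := 1 + 2 * β with hBc
  have hBc0 : 0 ≤ Bc := by positivity
  -- the constant: site part `T/2 + 1 + A(1+κ)`, bond part `2 · 2Bc(1+κ)` (each bounded by the same per-unit constant)
  set C : ℝ≥0∞ := ENNReal.ofReal (T / 2 + 1) + ENNReal.ofReal A * (1 + κ) + 2 * (ENNReal.ofReal (2 * Bc) * (1 + κ))
    with hC
  have hκtop : ∀ (N : ℕ) (k : Fin N), κ ≠ ⊤ := fun N k =>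
    (pinnedChain_lintegral_position_pow_sixteen_le hω hl.le hβ.le hT k).2
  refine ⟨C, ?_, fun N R hRN => ?_⟩
  · -- finiteness (use any site of any nonempty chain for `κ < ∞`; `κ` does not depend on `N`)
    have hk : κ ≠ ⊤ := hκtop 1 ⟨0, by norm_num⟩
    simp only [hC]
    have h1 : (1 : ℝ≥0∞) + κ ≠ ⊤ := by simp [hk]
    exact ENNReal.add_ne_top.2 ⟨ENNReal.add_ne_top.2 ⟨ENNReal.ofReal_ne_top, ENNReal.mul_ne_top ENNReal.ofReal_ne_top h1⟩,
      ENNReal.mul_ne_top (by norm_num) (ENNReal.mul_ne_top ENNReal.ofReal_ne_top h1)⟩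
  set μ := P.gibbsMeasure N T with hμ
  haveI : IsProbabilityMeasure μ := pinnedChain_isProbabilityMeasure_gibbsMeasure hω hl.le hβ.le γ N hT
  have hU0 : ∀ r, 0 ≤ P.U r := fun r => pinnedChain_U_nonneg β γ hω.le hl.le r
  have hV0 : ∀ r, 0 ≤ P.V r := fun r => by show 0 ≤ r ^ 2 / 2 + β * r ^ 4 / 4; positivity
  have hVe : ∀ r, P.V (-r) = P.V r := fun r => by
    show (-r) ^ 2 / 2 + β * (-r) ^ 4 / 4 = r ^ 2 / 2 + β * r ^ 4 / 4; ring
  -- the chain sites of the window `{-(R+1), …, R+1}`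
  have hsite : ∀ j : ℕ, j < 2 * R + 3 → 0 ≤ -((R : ℤ) + 1) + j + ((N - 1) / 2 : ℕ) ∧
      -((R : ℤ) + 1) + j + ((N - 1) / 2 : ℕ) < N := fun j hj => by constructor <;> omega
  set m : ℕ → Fin N := fun j => if h : j < 2 * R + 3 then ⟨(-((R : ℤ) + 1) + j + ((N - 1) / 2 : ℕ)).toNat, by
    have := hsite j h; omega⟩ else ⟨0, by omega⟩ with hmdef
  have hm : ∀ j : ℕ, j < 2 * R + 3 → ∀ z : PhaseSpace N, ι N z ((0 : ℤ) - ↑(R + 1) + j) = (z.1 (m j), z.2 (m j)) := by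
    intro j hj z
    refine centredEmbedding_apply_of_eq ι hι z _ (m j) ?_
    simp only [hmdef, dif_pos hj]
    have := hsite j hj
    push_cast
    omega
  -- one-site sixteenth moments and Gaussian second moments, at every chain site
  have h16 : ∀ k : Fin N, ∫⁻ z, ENNReal.ofReal (z.1 k ^ 16) ∂μ ≤ κ := fun k =>
    (pinnedChain_lintegral_position_pow_sixteen_le hω hl.le hβ.le hT k).1
  have hp2 : ∀ k : Fin N, ∫⁻ z, ENNReal.ofReal (z.2 k ^ 2 / 2) ∂μ = ENNReal.ofReal (T / 2) := by
    intro k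
    obtain ⟨hint, hval⟩ := commonPastBound_gibbsEvenMoments ω₂ lam β γ hω hl.le hβ.le T hT N k 1
    simp only [Finset.prod_range_one, Nat.cast_zero, mul_zero, zero_add, mul_one, pow_one] at hint hval
    have hint' : Integrable (fun z : PhaseSpace N => z.2 k ^ 2 / 2) μ := hint.div_const 2
    rw [← ofReal_integral_eq_lintegral_ofReal hint' (ae_of_all _ fun z => by positivity), integral_div, hval]
  -- per-site bound
  have hS : ∀ k : Fin N, ∫⁻ z, ENNReal.ofReal (z.2 k ^ 2 / 2 + P.U (z.1 k) + 1) ∂μ ≤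
      ENNReal.ofReal (T / 2 + 1) + ENNReal.ofReal A * (1 + κ) := by
    intro k
    have hpt : ∀ z : PhaseSpace N, ENNReal.ofReal (z.2 k ^ 2 / 2 + P.U (z.1 k) + 1) ≤
        ENNReal.ofReal (z.2 k ^ 2 / 2) + 1 + ENNReal.ofReal A * (1 + ENNReal.ofReal (z.1 k ^ 16)) := by
      intro z
      have hU := pinnedChain_U_le_sixteen hω.le hl.le β γ (z.1 k)
      rw [← hA] at hU
      calc ENNReal.ofReal (z.2 k ^ 2 / 2 + P.U (z.1 k) + 1)
          ≤ ENNReal.ofReal (z.2 k ^ 2 / 2 + 1 + A * (1 + z.1 k ^ 16)) := ENNReal.ofReal_le_ofReal (by linarith)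
        _ = ENNReal.ofReal (z.2 k ^ 2 / 2) + 1 + ENNReal.ofReal A * (1 + ENNReal.ofReal (z.1 k ^ 16)) := by
            rw [ENNReal.ofReal_add (by positivity) (by positivity), ENNReal.ofReal_add (by positivity) zero_le_one,
              ENNReal.ofReal_one, ENNReal.ofReal_mul hA0, ENNReal.ofReal_add zero_le_one (by positivity),
              ENNReal.ofReal_one]
    have hm1 : Measurable fun z : PhaseSpace N => ENNReal.ofReal (z.2 k ^ 2 / 2) := by fun_prop
    have hm2 : Measurable fun z : PhaseSpace N => ENNReal.ofReal A * (1 + ENNReal.ofReal (z.1 k ^ 16)) := by fun_prop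
    have hm3 : Measurable fun z : PhaseSpace N => ENNReal.ofReal (z.1 k ^ 16) := by fun_prop
    calc ∫⁻ z, ENNReal.ofReal (z.2 k ^ 2 / 2 + P.U (z.1 k) + 1) ∂μ
        ≤ ∫⁻ z, (ENNReal.ofReal (z.2 k ^ 2 / 2) + 1 + ENNReal.ofReal A * (1 + ENNReal.ofReal (z.1 k ^ 16))) ∂μ :=
          lintegral_mono hpt
      _ = (∫⁻ z, ENNReal.ofReal (z.2 k ^ 2 / 2) ∂μ) + 1 + ENNReal.ofReal A * (1 + ∫⁻ z, ENNReal.ofReal (z.1 k ^ 16) ∂μ) := by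
          rw [lintegral_add_right _ hm2, lintegral_add_left hm1, lintegral_const, measure_univ, mul_one,
            lintegral_const_mul _ (f := fun z : PhaseSpace N => 1 + ENNReal.ofReal (z.1 k ^ 16)) (by fun_prop),
            lintegral_add_left (f := fun _ : PhaseSpace N => (1 : ℝ≥0∞)) measurable_const, lintegral_const,
            measure_univ, mul_one]
      _ ≤ ENNReal.ofReal (T / 2) + 1 + ENNReal.ofReal A * (1 + κ) := by
          rw [hp2 k]
          exact add_le_add le_rfl (mul_le_mul_right (add_le_add le_rfl (h16 k)) _)
      _ = ENNReal.ofReal (T / 2 + 1) + ENNReal.ofReal A * (1 + κ) := by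
          rw [ENNReal.ofReal_add (by positivity) zero_le_one, ENNReal.ofReal_one]
  -- per-bond bound
  have hB : ∀ k k' : Fin N, ∫⁻ z, ENNReal.ofReal (P.V (z.1 k' - z.1 k)) ∂μ ≤ ENNReal.ofReal (2 * Bc) * (1 + κ) := by
    intro k k'
    have hpt : ∀ z : PhaseSpace N, ENNReal.ofReal (P.V (z.1 k' - z.1 k)) ≤
        ENNReal.ofReal Bc * (1 + ENNReal.ofReal (z.1 k ^ 16)) + ENNReal.ofReal Bc * (1 + ENNReal.ofReal (z.1 k' ^ 16)) := by
      intro z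
      have hV := pinnedChain_V_sub_le_sixteen ω₂ lam hβ.le γ (z.1 k) (z.1 k')
      calc ENNReal.ofReal (P.V (z.1 k' - z.1 k)) ≤ ENNReal.ofReal (Bc * (1 + z.1 k ^ 16) + Bc * (1 + z.1 k' ^ 16)) :=
            ENNReal.ofReal_le_ofReal (by rw [hBc]; linarith)
        _ = _ := by
            rw [ENNReal.ofReal_add (p := Bc * (1 + z.1 k ^ 16)) (q := Bc * (1 + z.1 k' ^ 16)) (by positivity)
                (by positivity), ENNReal.ofReal_mul hBc0, ENNReal.ofReal_mul hBc0,
              ENNReal.ofReal_add (p := 1) (q := z.1 k ^ 16) zero_le_one (by positivity),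
              ENNReal.ofReal_add (p := 1) (q := z.1 k' ^ 16) zero_le_one (by positivity), ENNReal.ofReal_one]
    have hm3 : ∀ k₀ : Fin N, Measurable fun z : PhaseSpace N => ENNReal.ofReal (z.1 k₀ ^ 16) := fun k₀ => by fun_prop
    have hmB : ∀ k₀ : Fin N, Measurable fun z : PhaseSpace N => ENNReal.ofReal Bc * (1 + ENNReal.ofReal (z.1 k₀ ^ 16)) :=
      fun k₀ => by fun_prop
    have hone : ∀ k₀ : Fin N, ∫⁻ z, ENNReal.ofReal Bc * (1 + ENNReal.ofReal (z.1 k₀ ^ 16)) ∂μ ≤ ENNReal.ofReal Bc * (1 + κ) := by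
      intro k₀
      rw [lintegral_const_mul _ (f := fun z : PhaseSpace N => 1 + ENNReal.ofReal (z.1 k₀ ^ 16)) (by fun_prop),
        lintegral_add_left (f := fun _ : PhaseSpace N => (1 : ℝ≥0∞)) measurable_const, lintegral_const,
        measure_univ, mul_one]
      exact mul_le_mul_right (add_le_add le_rfl (h16 k₀)) _
    calc ∫⁻ z, ENNReal.ofReal (P.V (z.1 k' - z.1 k)) ∂μ
        ≤ ∫⁻ z, (ENNReal.ofReal Bc * (1 + ENNReal.ofReal (z.1 k ^ 16)) +
            ENNReal.ofReal Bc * (1 + ENNReal.ofReal (z.1 k' ^ 16))) ∂μ := lintegral_mono hpt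
      _ = (∫⁻ z, ENNReal.ofReal Bc * (1 + ENNReal.ofReal (z.1 k ^ 16)) ∂μ) +
            ∫⁻ z, ENNReal.ofReal Bc * (1 + ENNReal.ofReal (z.1 k' ^ 16)) ∂μ := lintegral_add_left (hmB k) _
      _ ≤ ENNReal.ofReal Bc * (1 + κ) + ENNReal.ofReal Bc * (1 + κ) := add_le_add (hone k) (hone k')
      _ = ENNReal.ofReal (2 * Bc) * (1 + κ) := by
          rw [ENNReal.ofReal_mul (by norm_num : (0:ℝ) ≤ 2), ENNReal.ofReal_ofNat]; ring
  -- BM's window bound for `W_{0,R+1}` and the two sums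
  have hW : ∀ z : PhaseSpace N, ENNReal.ofReal (P.bmLocalEnergy 0 (R + 1) (ι N z)) ≤
      (∑ j ∈ Finset.range (2 * (R + 1) + 1), ENNReal.ofReal ((z.2 (m j)) ^ 2 / 2 + P.U (z.1 (m j)) + 1)) +
        2 * ∑ j ∈ Finset.range (2 * (R + 1)), ENNReal.ofReal (P.V (z.1 (m (j + 1)) - z.1 (m j))) := by
    intro z
    have h := bmLocalEnergy_le_window (P := P) hVe 0 (R + 1) (ι N z)
    have hsites : ∀ j ∈ Finset.range (2 * (R + 1) + 1),
        ((ι N z (0 - ↑(R + 1) + j)).2 ^ 2 / 2 + P.U (ι N z (0 - ↑(R + 1) + j)).1 + 1) =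
          (z.2 (m j)) ^ 2 / 2 + P.U (z.1 (m j)) + 1 := fun j hj => by
      rw [hm j (by have := Finset.mem_range.1 hj; omega) z]
    have hbonds : ∀ j ∈ Finset.range (2 * (R + 1)),
        P.V ((ι N z (0 - ↑(R + 1) + j + 1)).1 - (ι N z (0 - ↑(R + 1) + j)).1) =
          P.V (z.1 (m (j + 1)) - z.1 (m j)) := fun j hj => by
      have hj' := Finset.mem_range.1 hj
      rw [hm j (by omega) z]
      have e : (0 : ℤ) - ↑(R + 1) + ↑j + 1 = 0 - ↑(R + 1) + ↑(j + 1) := by push_cast; ring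
      rw [e, hm (j + 1) (by omega) z]
    rw [Finset.sum_congr rfl hsites, Finset.sum_congr rfl hbonds] at h
    calc ENNReal.ofReal (P.bmLocalEnergy 0 (R + 1) (ι N z))
        ≤ ENNReal.ofReal ((∑ j ∈ Finset.range (2 * (R + 1) + 1), ((z.2 (m j)) ^ 2 / 2 + P.U (z.1 (m j)) + 1)) +
            2 * ∑ j ∈ Finset.range (2 * (R + 1)), P.V (z.1 (m (j + 1)) - z.1 (m j))) := ENNReal.ofReal_le_ofReal h
      _ = _ := by
          rw [ENNReal.ofReal_add (Finset.sum_nonneg fun j _ => by have := hU0 (z.1 (m j)); positivity)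
              (mul_nonneg zero_le_two (Finset.sum_nonneg fun j _ => hV0 _)),
            ENNReal.ofReal_sum_of_nonneg fun j _ => by have := hU0 (z.1 (m j)); positivity,
            ENNReal.ofReal_mul zero_le_two, ENNReal.ofReal_ofNat, ENNReal.ofReal_sum_of_nonneg fun j _ => hV0 _]
  have hmS : ∀ j, Measurable fun z : PhaseSpace N => ENNReal.ofReal ((z.2 (m j)) ^ 2 / 2 + P.U (z.1 (m j)) + 1) := by
    intro j
    have hUm : Measurable P.U := measurable_pinnedChain_U ω₂ lam β γ
    exact ((((measurable_pi_apply (m j)).comp measurable_snd).pow_const 2 |>.div_const 2).add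
      (hUm.comp ((measurable_pi_apply (m j)).comp measurable_fst)) |>.add_const 1).ennreal_ofReal
  have hmBd : ∀ j, Measurable fun z : PhaseSpace N => ENNReal.ofReal (P.V (z.1 (m (j + 1)) - z.1 (m j))) := by
    intro j
    have hVm : Measurable P.V := (show Continuous P.V from by
      show Continuous fun r : ℝ => r ^ 2 / 2 + β * r ^ 4 / 4; fun_prop).measurable
    exact (hVm.comp (((measurable_pi_apply (m (j + 1))).comp measurable_fst).sub
      ((measurable_pi_apply (m j)).comp measurable_fst))).ennreal_ofReal
  calc ∫⁻ z, ENNReal.ofReal (P.bmLocalEnergy 0 (R + 1) (ι N z)) ∂μ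
      ≤ ∫⁻ z, ((∑ j ∈ Finset.range (2 * (R + 1) + 1), ENNReal.ofReal ((z.2 (m j)) ^ 2 / 2 + P.U (z.1 (m j)) + 1)) +
          2 * ∑ j ∈ Finset.range (2 * (R + 1)), ENNReal.ofReal (P.V (z.1 (m (j + 1)) - z.1 (m j)))) ∂μ :=
        lintegral_mono hW
    _ = (∑ j ∈ Finset.range (2 * (R + 1) + 1), ∫⁻ z, ENNReal.ofReal ((z.2 (m j)) ^ 2 / 2 + P.U (z.1 (m j)) + 1) ∂μ) +
          2 * ∑ j ∈ Finset.range (2 * (R + 1)), ∫⁻ z, ENNReal.ofReal (P.V (z.1 (m (j + 1)) - z.1 (m j))) ∂μ := by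
        rw [lintegral_add_left (Finset.measurable_sum _ fun j _ => hmS j), lintegral_finsetSum _ fun j _ => hmS j,
          lintegral_const_mul _ (Finset.measurable_sum _ fun j _ => hmBd j), lintegral_finsetSum _ fun j _ => hmBd j]
    _ ≤ (∑ j ∈ Finset.range (2 * (R + 1) + 1), (ENNReal.ofReal (T / 2 + 1) + ENNReal.ofReal A * (1 + κ))) +
          2 * ∑ j ∈ Finset.range (2 * (R + 1)), (ENNReal.ofReal (2 * Bc) * (1 + κ)) := by
        gcongr with j _ j _
        · exact hS (m j)
        · exact hB (m j) (m (j + 1))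
    _ ≤ (2 * R + 3 : ℝ≥0∞) * C := by
        set X : ℝ≥0∞ := ENNReal.ofReal (T / 2 + 1) + ENNReal.ofReal A * (1 + κ) with hX
        set Y : ℝ≥0∞ := ENNReal.ofReal (2 * Bc) * (1 + κ) with hY
        have hCXY : C = X + 2 * Y := rfl
        rw [Finset.sum_const, Finset.sum_const, Finset.card_range, Finset.card_range, nsmul_eq_mul, nsmul_eq_mul, hCXY]
        have e1 : ((2 * (R + 1) + 1 : ℕ) : ℝ≥0∞) = 2 * R + 3 := by push_cast; ring
        have hle : ((2 * (R + 1) : ℕ) : ℝ≥0∞) ≤ 2 * R + 3 := by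
          push_cast
          calc (2 * ((R : ℝ≥0∞) + 1)) = 2 * R + 2 := by ring
            _ ≤ 2 * R + 3 := add_le_add_right (by norm_num : (2 : ℝ≥0∞) ≤ 3) _
        rw [e1]
        calc (2 * (R : ℝ≥0∞) + 3) * X + 2 * (((2 * (R + 1) : ℕ) : ℝ≥0∞) * Y)
            ≤ (2 * (R : ℝ≥0∞) + 3) * X + 2 * ((2 * (R : ℝ≥0∞) + 3) * Y) := by gcongr
          _ = (2 * (R : ℝ≥0∞) + 3) * (X + 2 * Y) := by ring

end EnergyMean


/-- **Registered sub-goal `stub_centredBoxEnergyMean`** (dynamic half of leaf (B₀), line `loomis-compact-horizon-witness`):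
the `N`-uniform `O(R)` mean of the local energy of the centred box under the free Gibbs measure
(`exists_lintegral_bmLocalEnergy_centred_le`, closed form). [folklore] -/
theorem stub_centredBoxEnergyMean :
    ∀ ω₂ lam β γ : ℝ, 0 < ω₂ → 0 < lam → 0 < β → ∀ T : ℝ, 0 < T →
      ∀ (ι : (N : ℕ) → Literature.MathematicalPhysics.KineticTheory.HeatConduction.PhaseSpace N → Literature.MathematicalPhysics.KineticTheory.HeatConduction.ChainConfig),
        (∀ (N : ℕ) (z : Literature.MathematicalPhysics.KineticTheory.HeatConduction.PhaseSpace N) (i : ℤ),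
          ι N z i = if h : 0 ≤ i + ((N - 1) / 2 : ℕ) ∧ i + ((N - 1) / 2 : ℕ) < N then
            (z.1 ⟨(i + ((N - 1) / 2 : ℕ)).toNat, by omega⟩, z.2 ⟨(i + ((N - 1) / 2 : ℕ)).toNat, by omega⟩)
            else (0, 0)) →
      ∃ C : ENNReal, C ≠ ⊤ ∧ ∀ (N R : ℕ), 2 * R + 4 ≤ N →
        ∫⁻ z, ENNReal.ofReal ((Literature.MathematicalPhysics.KineticTheory.HeatConduction.pinnedChain ω₂ lam β γ).bmLocalEnergy 0 (R + 1) (ι N z))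
            ∂((Literature.MathematicalPhysics.KineticTheory.HeatConduction.pinnedChain ω₂ lam β γ).gibbsMeasure N T) ≤ (2 * R + 3 : ENNReal) * C :=
  fun _ _ _ γ hω hl hβ _ hT ι hι => exists_lintegral_bmLocalEnergy_centred_le hω hl hβ hT γ ι hι

end Summit.AtomisticToContinuum.FouriersLaw.Theorems.AbelThermodynamicLimit.LoomisCompactHorizonWitness

end
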